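import Literature.IUT.HodgeTheaters.PuncturedEllipticCoveringsArrowClaimsOfLaws
import HarnessLib

/-!
# [IUTchI] §1 p. 38 — the clause `[Δ_X̲ : jKer] = l` (`Δ_ε⁺ ≅ ℤ/lℤ`) DERIVED from print's Δ_ε-level sentences

Mochizuki, *Inter-universal Teichmüller theory I*, kurims manuscript (May 2020), §1 pp. 37–38
[cite: Mochizuki2012, IUTchI §1 pp.37-38] (D-0012 claim key, status disputed).  PROOF-ONLY; file B2 of the
«hA re-grounding» series (abc-iut-L5-lead RULINGS #58 (10) GO); companion of `PuncturedEllipticCoverings.lean`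
(p404449), `…Cusps.lean` (p424023), `…ArrowClaimsOfLaws.lean` (B1).  No `def`, no instance, no new `Prop` fact.

Print (p. 37 l. 33 – p. 38 l. 7): "we obtain a natural exact sequence `0 → I_ε′ × I_ε″ → Δ_ε → Δ_E ⊗ (ℤ/lℤ) → 0`
… [so we have noncanonical isomorphisms `I_ε′ ≅ ℤ/lℤ ≅ I_ε″`] … `ι` acts on `Δ_E ⊗ (ℤ/lℤ)` via multiplication
by `−1`.  In particular, since `l` is odd, … a decomposition into eigenspaces `Δ_ε ⥲ Δ_ε⁺ × Δ_ε⁻` … the natural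
composite maps `I_ε′ ↪ Δ_ε ↠ Δ_ε⁺`, `I_ε″ ↪ Δ_ε ↠ Δ_ε⁺` determine isomorphisms `I_ε′ ⥲ Δ_ε⁺`, `I_ε″ ⥲ Δ_ε⁺`."
The typed clause `ArrowCoveringClaims.jKer_relindex : [Δ_X̲ : jKer] = l` (`jKer = Ker(Δ_X̲ ↠ Δ_ε⁺)`) is the
statement `Δ_ε⁺ ≅ ℤ/lℤ`.

THE LAWS (explicit hypothesis binders; all statements about the standard objects `I_x`, `Δ_X̲^{ab} ⊗ ℤ/l`,
`Δ_ε = Δ_X̲ / Ker(Δ_X̲ ↠ Δ_ε)`, never about the §1 construction `jKer`, `Π_{X̲→}`):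
* (L0) `hfin : [Δ_X̲ : Ker(Δ_X̲ ↠ Δ_X̲^{ab} ⊗ ℤ/l)] ≠ 0` — "`Δ_X̲^{ab} ⊗ (ℤ/lℤ)`" is finite (`Δ_X̲` topologically
  finitely generated; supplied from [AbsTopI] Prop 2.2 `GeomTFG` by `modLKer_relIndex_ne_zero_of_tfg`, p424558);
* (L1) `hgen : ∃ z ∈ I_ε′, I_ε′ ≤ closure ⟨z⟩` — the cusp inertia group is procyclic (`≅ Ẑ(1)`);
* (L2a) `hord : [I_ε′ · Ker(Δ_X̲ ↠ Δ_ε) : Ker(Δ_X̲ ↠ Δ_ε)] = l` — "`I_ε′ ≅ ℤ/lℤ`" for the image of `I_ε′` in `Δ_ε`;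
* (L2c) `hind : I_ε′ ∩ (I_ε″ · Ker(Δ_X̲ ↠ Δ_ε)) ⊆ Ker(Δ_X̲ ↠ Δ_ε)` — "`0 → I_ε′ × I_ε″ → Δ_ε`" is exact (the two
  images meet trivially);
* (L3) `hL3` "`ι` acts on `Δ_E ⊗ (ℤ/lℤ)` via `−1`", (L4) `hI3` "`μ_l ⊆ k`", `hι` — as in B1.

WHAT IS PROVED: `CuspGalois.jKer_relindex_of_laws … : D.jKer.relIndex D.DeltaXbar = D.l` — the typed clause
VERBATIM — via: (i) a generic cyclic-quotient lemma (`relIndex_dvd_iff_of_le_zpowers_sup`); (ii) closedness of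
every subgroup between `Ker(Δ_X̲ ↠ Δ_X̲^{ab} ⊗ ℤ/l)` and `Δ_X̲` under (L0) (`le_zpowers_sup_of_le_closure`), so that
`Δ_X̲ = ⟨z⟩ · jKer` by B1's `inertia_ε1_sup_of_laws` (UPPER bound `[Δ_X̲ : jKer] ∣ l`); (iii) the `ι`-TRACE
`j ↦ j · ι̲ j ι̲⁻¹`, which maps `jKer` into `Ker(Δ_X̲ ↠ Δ_ε)` (`CuspGalois.trace_mem_deltaEpsKer_of_mem_jKer`:
`Δ_ε` is abelian of exponent `l`, `ι̲` acts on it as an involution, and each generator `[x, ι̲']` of `jKer` has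
trace `x · ι̲²(x)⁻¹ = 1`), whence `z^d ∈ jKer ⇒ z^d ∈ I_ε′ ∩ I_ε″·Ker ⊆ Ker(Δ_X̲ ↠ Δ_ε) ⇒ l ∣ d` by (L2c), (L2a)
(LOWER bound).  The cokernel clause "`→ Δ_E ⊗ (ℤ/lℤ) → 0`" and its order `l²` are NOT needed.

HONEST FRAMING: nothing here asserts abc proved or refuted or takes a side on [IUTchIII] Cor. 3.12; a clause
derived under named laws is an implication, not a discharge of the laws; typed ≠ inhabited ≠ discharged.
-/

namespace Literature.IUT.HodgeTheaters

namespace PuncturedEllipticData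

open scoped Pointwise
open Topology Literature.AnabelianGeometry.AbsoluteAnabelian

universe u

/-! ### Generic group theory: a normal subgroup of a subgroup with cyclic quotient -/

section Generic

variable {G : Type*} [Group G]

/-- If `N ≤ A` and `⁅A, A⁆ ⊆ N`, then `N` is normal in `A`. (Elementary.) [claim: Mochizuki2012, status: disputed] -/
theorem normal_subgroupOf_of_commutator_le {A N : Subgroup G} (hNA : N ≤ A) (h : ⁅A, A⁆ ≤ N) :
    (N.subgroupOf A).Normal := by
  refine (Subgroup.normal_subgroupOf_iff hNA).mpr fun n a hn ha => ?_
  have hc : a * n * a⁻¹ * n⁻¹ ∈ N := by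
    have := Subgroup.commutator_mem_commutator ha (hNA hn)
    rw [commutatorElement_def] at this
    exact h this
  have e : a * n * a⁻¹ = (a * n * a⁻¹ * n⁻¹) * n := by group
  rw [e]
  exact N.mul_mem hc hn

/-- **Cyclic quotient lemma.** If `N ≤ A ⊆ ⟨g⟩·N` with `N ⊴ A` and `g ∈ A`, then `g^d ∈ N ↔ [A : N] ∣ d`
(the quotient `A/N` is cyclic, generated by the class of `g`, of order `[A : N]`; `[A : N] = 0` if infinite).
(Elementary.) [claim: Mochizuki2012, status: disputed] -/
theorem relIndex_dvd_iff_of_le_zpowers_sup {A N : Subgroup G} (hNA : N ≤ A)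
    (hnorm : (N.subgroupOf A).Normal) {g : G} (hg : g ∈ A) (hgen : A ≤ Subgroup.zpowers g ⊔ N) (d : ℕ) :
    g ^ d ∈ N ↔ N.relIndex A ∣ d := by
  haveI := hnorm
  set q : A ⧸ N.subgroupOf A := QuotientGroup.mk ⟨g, hg⟩ with hq
  -- every class is a power of `q`
  have hcyc : ∀ x : A ⧸ N.subgroupOf A, x ∈ Subgroup.zpowers q := by
    intro x
    induction x using QuotientGroup.induction_on with
    | H a =>
      have ha : (a : G) ∈ Subgroup.zpowers g ⊔ N := hgen a.2
      have hsub : (Subgroup.zpowers g ⊔ N).subgroupOf A =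
          (Subgroup.zpowers g).subgroupOf A ⊔ N.subgroupOf A :=
        Subgroup.subgroupOf_sup (Subgroup.zpowers_le.mpr hg) hNA
      have ha' : a ∈ (Subgroup.zpowers g).subgroupOf A ⊔ N.subgroupOf A := by
        rw [← hsub, Subgroup.mem_subgroupOf]; exact ha
      have ha'' : (a : A) ∈ (((Subgroup.zpowers g).subgroupOf A ⊔ N.subgroupOf A : Subgroup A) : Set A) := ha'
      rw [Subgroup.mul_normal] at ha''
      obtain ⟨y, hy, n, hn, hyn⟩ := Set.mem_mul.mp ha''
      rw [SetLike.mem_coe, Subgroup.mem_subgroupOf, Subgroup.mem_zpowers_iff] at hy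
      obtain ⟨k, hk⟩ := hy
      have hyk : y = (⟨g, hg⟩ : A) ^ k := Subtype.ext (by rw [Subgroup.coe_zpow]; exact hk.symm)
      rw [← hyn, QuotientGroup.mk_mul, (QuotientGroup.eq_one_iff n).mpr hn, mul_one, hyk,
        QuotientGroup.mk_zpow]
      exact ⟨k, rfl⟩
  have hord : orderOf q = N.relIndex A := by
    rw [Subgroup.relIndex, Subgroup.index_eq_card]
    exact orderOf_eq_card_of_forall_mem_zpowers hcyc
  rw [← hord, orderOf_dvd_iff_pow_eq_one, hq, ← QuotientGroup.mk_pow, QuotientGroup.eq_one_iff,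
    Subgroup.mem_subgroupOf, Subgroup.coe_pow]

/-- In the situation of `relIndex_dvd_iff_of_le_zpowers_sup`: if `g^l ∈ N` and `g^d ∈ N ⇒ l ∣ d`, then
`[A : N] = l`. (Elementary.) [claim: Mochizuki2012, status: disputed] -/
theorem relIndex_eq_of_le_zpowers_sup {A N : Subgroup G} (hNA : N ≤ A)
    (hnorm : (N.subgroupOf A).Normal) {g : G} (hg : g ∈ A) (hgen : A ≤ Subgroup.zpowers g ⊔ N) {l : ℕ}
    (hl : g ^ l ∈ N) (hmin : ∀ d : ℕ, g ^ d ∈ N → l ∣ d) : N.relIndex A = l := by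
  have key := relIndex_dvd_iff_of_le_zpowers_sup hNA hnorm hg hgen
  exact Nat.dvd_antisymm ((key l).mp hl) (hmin _ ((key _).mpr (dvd_refl _)))

end Generic

variable {D : PuncturedEllipticData.{u}}

/-! ### Under (L0): subgroups between `Ker(Δ_X̲ ↠ Δ_X̲^{ab} ⊗ ℤ/l)` and `Δ_X̲` are closed -/

/-- Under (L0) `[Δ_X̲ : Ker(Δ_X̲ ↠ Δ_X̲^{ab} ⊗ ℤ/l)] ≠ 0`: if `I ⊆ closure ⟨z⟩` with `z ∈ Δ_X̲`, then `I ⊆ ⟨z⟩ · N`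
for every `N` between `Ker(Δ_X̲ ↠ Δ_X̲^{ab} ⊗ ℤ/l)` and `Δ_X̲` (such `⟨z⟩ · N` is closed: finitely many cosets of
the closed kernel). ([IUTchI] §1 p.37) [claim: Mochizuki2012, status: disputed] -/
theorem le_zpowers_sup_of_le_closure (hfin : D.modLKer.relIndex D.DeltaXbar ≠ 0)
    {N I : Subgroup D.PiC} (hMN : D.modLKer ≤ N) (hN : N ≤ D.DeltaXbar) {z : D.PiC} (hz : z ∈ D.DeltaXbar)
    (hI : I ≤ (Subgroup.zpowers z).topologicalClosure) : I ≤ Subgroup.zpowers z ⊔ N := by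
  have hK : D.modLKer ≤ Subgroup.zpowers z ⊔ N := hMN.trans le_sup_right
  have hKΔ : Subgroup.zpowers z ⊔ N ≤ D.DeltaXbar := sup_le (Subgroup.zpowers_le.mpr hz) hN
  have hfiK : D.modLKer.relIndex (Subgroup.zpowers z ⊔ N) ≠ 0 := fun h0 =>
    hfin (Subgroup.relIndex_eq_zero_of_le_right hKΔ h0)
  have hcl : IsClosed ((Subgroup.zpowers z ⊔ N : Subgroup D.PiC) : Set D.PiC) :=
    ArrowOpen.isClosed_of_le_of_relIndex_ne_zero hK D.isClosed_modLKer hfiK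
  exact hI.trans (Subgroup.topologicalClosure_minimal _ le_sup_left hcl)

/-- `Ker(Δ_X̲ ↠ Δ_ε)` is normal in `Δ_X̲` (it contains the commutators); likewise between any `N ⊇ Ker(Δ_X̲ ↠
Δ_X̲^{ab} ⊗ ℤ/l)` and `A ⊆ Δ_X̲`. ([IUTchI] §1 p.37) [claim: Mochizuki2012, status: disputed] -/
theorem normal_subgroupOf_of_modLKer_le {A N : Subgroup D.PiC} (hMN : D.modLKer ≤ N) (hNA : N ≤ A)
    (hA : A ≤ D.DeltaXbar) : (N.subgroupOf A).Normal :=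
  normal_subgroupOf_of_commutator_le hNA
    ((Subgroup.commutator_mono hA hA).trans
      ((le_sup_left.trans (Subgroup.le_topologicalClosure _)).trans hMN))

namespace CuspGalois

variable (C : D.CuspGalois)

/-! ### `Ker(Δ_X̲ ↠ Δ_ε)` is `Π_C̲`-stable under (L4) -/

include C in
/-- Under (L4): conjugation by `g ∈ Π_C̲` preserves `Ker(Δ_X̲ ↠ Δ_ε)` (the kernel and the inertia of the nonzero
cusps `≠ ε′, ε″` are permuted). ([IUTchI] §1 p.37) [claim: Mochizuki2012, status: disputed] -/
theorem conj_mem_deltaEpsKer_of_inertiaCentral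
    (hI3 : ∀ (x : D.Cusp), ∀ g ∈ D.PiXbar, ∀ z ∈ D.inertia x, g * z * g⁻¹ * z⁻¹ ∈ D.modLKer)
    {g n : D.PiC} (hg : g ∈ D.PiCbar) (hn : n ∈ D.deltaEpsKer) : g * n * g⁻¹ ∈ D.deltaEpsKer := by
  haveI := C.normal_modLKer
  suffices hle : D.deltaEpsKer ≤ D.deltaEpsKer.comap (MulAut.conj g).toMonoidHom by
    have := hle hn
    simpa only [Subgroup.mem_comap, MulEquiv.coe_toMonoidHom, MulAut.conj_apply] using this
  refine sup_le ?_ (iSup_le fun x => ?_)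
  · intro m hm
    simp only [Subgroup.mem_comap, MulEquiv.coe_toMonoidHom, MulAut.conj_apply]
    exact D.modLKer_le_deltaEpsKer ((C.normal_modLKer).conj_mem m hm g)
  · intro z hz
    simp only [Subgroup.mem_comap, MulEquiv.coe_toMonoidHom, MulAut.conj_apply]
    have h := C.conj_inertia_mem hI3 g x.1 hz
    have hx' := C.act_mem_awayCusps hg x.2
    refine (sup_le D.modLKer_le_deltaEpsKer ?_) h
    have : D.inertia (C.act g x.1) ≤ ⨆ (y : {y : D.Cusp // D.IsNonzeroCusp y ∧ y ≠ D.ε1 ∧ y ≠ D.ε2}),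
        D.inertia y.1 := le_iSup (fun y : {y : D.Cusp // D.IsNonzeroCusp y ∧ y ≠ D.ε1 ∧ y ≠ D.ε2} =>
          D.inertia y.1) ⟨C.act g x.1, hx'⟩
    exact this.trans le_sup_right

/-! ### The `ι`-trace kills `jKer` modulo `Ker(Δ_X̲ ↠ Δ_ε)` -/

/-- Two elements of `Δ_C̲ ∖ Δ_X̲` differ by an element of `Δ_X̲` (`[Π_C : Π_X] = 2`). ([IUTchI] §1 p.37)
[claim: Mochizuki2012, status: disputed] -/
theorem inv_mul_mem_deltaXbar_of_not_mem {c c' : D.PiC} (hc : c ∈ D.DeltaCbar) (hcX : c ∉ D.DeltaXbar)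
    (hc' : c' ∈ D.DeltaCbar) (hcX' : c' ∉ D.DeltaXbar) : c⁻¹ * c' ∈ D.DeltaXbar := by
  have h1 : c ∉ D.PiX := D.not_mem_piX_of_mem_deltaCbar hc hcX
  have h2 : c' ∉ D.PiX := D.not_mem_piX_of_mem_deltaCbar hc' hcX'
  have h3 : c⁻¹ * c' ∈ D.PiX := by
    rw [Subgroup.mul_mem_iff_of_index_two D.index_piX, Subgroup.inv_mem_iff]
    exact ⟨fun h => absurd h h1, fun h => absurd h h2⟩
  exact ⟨⟨h3, D.PiCbar.mul_mem (D.PiCbar.inv_mem hc.1) hc'.1⟩,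
    D.DeltaC.mul_mem (D.DeltaC.inv_mem hc.2) hc'.2⟩

include C in
/-- **The `ι`-trace**: under (L4), for `ι̲ ∈ Δ_C̲ ∖ Δ_X̲` and `j ∈ jKer`, `j · ι̲ j ι̲⁻¹ ∈ Ker(Δ_X̲ ↠ Δ_ε)` — in the
abelian group `Δ_ε` (exponent `l`, `ι` an involution) the class of each generator `[x, ι̲']` of `jKer` is
`x̄ − ι(x̄)`, whose `ι`-trace `(x̄ − ιx̄) + ι(x̄ − ιx̄)` vanishes. ([IUTchI] §1 p.38) [claim: Mochizuki2012, status: disputed] -/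
theorem trace_mem_deltaEpsKer_of_mem_jKer
    (hI3 : ∀ (x : D.Cusp), ∀ g ∈ D.PiXbar, ∀ z ∈ D.inertia x, g * z * g⁻¹ * z⁻¹ ∈ D.modLKer)
    {c : D.PiC} (hc : c ∈ D.DeltaCbar) (hcX : c ∉ D.DeltaXbar) {j : D.PiC} (hj : j ∈ D.jKer) :
    j * (c * j * c⁻¹) ∈ D.deltaEpsKer := by
  have hΔn : D.DeltaXbar.Normal := C.normal_deltaXbar
  -- the quotient `B = Δ_X̲ / Ker(Δ_X̲ ↠ Δ_ε)`: abelian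
  set N : Subgroup ↥D.DeltaXbar := D.deltaEpsKer.subgroupOf D.DeltaXbar with hN
  haveI hNn : N.Normal := D.normal_subgroupOf_of_modLKer_le D.modLKer_le_deltaEpsKer
    D.deltaEpsKer_le_deltaXbar le_rfl
  have hcommB : ∀ a b : ↥D.DeltaXbar ⧸ N, a * b = b * a := by
    have hle : _root_.commutator ↥D.DeltaXbar ≤ N := by
      intro x hx
      rw [hN, Subgroup.mem_subgroupOf]
      have hx' : (x : D.PiC) ∈ ⁅D.DeltaXbar, D.DeltaXbar⁆ := by
        rw [← Subgroup.map_subtype_commutator]; exact ⟨x, hx, rfl⟩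
      exact D.modLKer_le_deltaEpsKer (Subgroup.le_topologicalClosure _ (Subgroup.mem_sup_left hx'))
    have hI : IsMulCommutative (↥D.DeltaXbar ⧸ N) :=
      Subgroup.Normal.quotient_commutative_iff_commutator_le.mpr hle
    exact fun a b => hI.is_comm.comm a b
  -- conjugation by `g ∈ Π_C` as an endomorphism of `Δ_X̲` …
  let φ : D.PiC → (↥D.DeltaXbar →* ↥D.DeltaXbar) := fun g =>
    { toFun := fun x => ⟨g * x * g⁻¹, hΔn.conj_mem (x : D.PiC) x.2 g⟩
      map_one' := Subtype.ext (by simp only [Subgroup.coe_one, mul_one, mul_inv_cancel])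
      map_mul' := fun x y => Subtype.ext (by simp only [Subgroup.coe_mul]; group) }
  have hφ_coe : ∀ (g : D.PiC) (x : ↥D.DeltaXbar), ((φ g x : ↥D.DeltaXbar) : D.PiC) = g * x * g⁻¹ :=
    fun g x => rfl
  -- … descending, for `g ∈ Π_C̲`, to `B` (Tier 1: `Ker(Δ_X̲ ↠ Δ_ε)` is `Π_C̲`-stable under (L4))
  have hφN : ∀ g : D.PiC, g ∈ D.PiCbar → N ≤ N.comap (φ g) := by
    intro g hg x hx
    rw [Subgroup.mem_comap, hN, Subgroup.mem_subgroupOf, hφ_coe]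
    rw [hN, Subgroup.mem_subgroupOf] at hx
    exact C.conj_mem_deltaEpsKer_of_inertiaCentral hI3 hg hx
  let ψ : ∀ g : D.PiC, g ∈ D.PiCbar → (↥D.DeltaXbar ⧸ N →* ↥D.DeltaXbar ⧸ N) := fun g hg =>
    QuotientGroup.map N N (φ g) (hφN g hg)
  have hψ_mk : ∀ (g : D.PiC) (hg : g ∈ D.PiCbar) (x : ↥D.DeltaXbar),
      ψ g hg (QuotientGroup.mk x) = QuotientGroup.mk (φ g x) :=
    fun g hg x => QuotientGroup.map_mk N N (φ g) (hφN g hg) x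
  -- elements of `Δ_X̲` act trivially on the abelian quotient `B`
  have hψ_triv : ∀ (a : D.PiC) (ha : a ∈ D.DeltaXbar) (haC : a ∈ D.PiCbar) (x : ↥D.DeltaXbar),
      ψ a haC (QuotientGroup.mk x) = QuotientGroup.mk x := by
    intro a ha haC x
    have e : φ a x = ⟨a, ha⟩ * x * ⟨a, ha⟩⁻¹ :=
      Subtype.ext (by simp only [hφ_coe, Subgroup.coe_mul, Subgroup.coe_inv])
    rw [hψ_mk a haC, e, QuotientGroup.mk_mul, QuotientGroup.mk_mul, QuotientGroup.mk_inv,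
      hcommB (QuotientGroup.mk ⟨a, ha⟩) (QuotientGroup.mk x), mul_assoc, mul_inv_cancel, mul_one]
  have hcC : c ∈ D.PiCbar := D.deltaCbar_le_piCbar hc
  -- `ι̲' = ι̲ · a` with `a ∈ Δ_X̲` acts on `B` as `ι̲` does
  have hψ_eq : ∀ (c' : D.PiC) (hc' : c' ∈ D.DeltaCbar) (_ : c' ∉ D.DeltaXbar) (x : ↥D.DeltaXbar),
      ψ c' (D.deltaCbar_le_piCbar hc') (QuotientGroup.mk x) = ψ c hcC (QuotientGroup.mk x) := by
    intro c' hc' hcX' x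
    have ha : c⁻¹ * c' ∈ D.DeltaXbar := inv_mul_mem_deltaXbar_of_not_mem hc hcX hc' hcX'
    have haC : c⁻¹ * c' ∈ D.PiCbar := D.piXbar_le_piCbar (D.deltaXbar_le_piXbar ha)
    have e : φ c' x = φ c (φ (c⁻¹ * c') x) := Subtype.ext (by simp only [hφ_coe]; group)
    calc ψ c' (D.deltaCbar_le_piCbar hc') (QuotientGroup.mk x)
        = QuotientGroup.mk (φ c' x) := hψ_mk c' (D.deltaCbar_le_piCbar hc') x
      _ = QuotientGroup.mk (φ c (φ (c⁻¹ * c') x)) := by rw [e]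
      _ = ψ c hcC (ψ (c⁻¹ * c') haC (QuotientGroup.mk x)) := by rw [hψ_mk (c⁻¹ * c') haC, hψ_mk c hcC]
      _ = ψ c hcC (QuotientGroup.mk x) := by rw [hψ_triv _ ha haC]
  -- `ι̲² ∈ Δ_X̲` acts trivially: `ι` is an involution of `B`
  have hψ_sq : ∀ x : ↥D.DeltaXbar, ψ c hcC (ψ c hcC (QuotientGroup.mk x)) = QuotientGroup.mk x := by
    intro x
    have hcc : c * c ∈ D.DeltaXbar :=
      ⟨⟨Subgroup.mul_self_mem_of_index_two D.index_piX c, D.PiCbar.mul_mem hcC hcC⟩,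
        D.DeltaC.mul_mem hc.2 hc.2⟩
    have hccC : c * c ∈ D.PiCbar := D.PiCbar.mul_mem hcC hcC
    have e : φ c (φ c x) = φ (c * c) x := Subtype.ext (by simp only [hφ_coe]; group)
    calc ψ c hcC (ψ c hcC (QuotientGroup.mk x))
        = QuotientGroup.mk (φ c (φ c x)) := by rw [hψ_mk c hcC, hψ_mk c hcC]
      _ = QuotientGroup.mk (φ (c * c) x) := by rw [e]
      _ = ψ (c * c) hccC (QuotientGroup.mk x) := (hψ_mk (c * c) hccC x).symm
      _ = QuotientGroup.mk x := hψ_triv _ hcc hccC x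
  -- the trace subgroup `S = {x ∈ Δ_X̲ | x̄ · ι(x̄) = 1}` (a subgroup since `B` is abelian)
  let S : Subgroup ↥D.DeltaXbar :=
    { carrier := {x | (QuotientGroup.mk x : ↥D.DeltaXbar ⧸ N) * ψ c hcC (QuotientGroup.mk x) = 1}
      mul_mem' := by
        intro x y hx hy
        simp only [Set.mem_setOf_eq, QuotientGroup.mk_mul, map_mul] at hx hy ⊢
        generalize (QuotientGroup.mk x : ↥D.DeltaXbar ⧸ N) = X at *
        generalize (QuotientGroup.mk y : ↥D.DeltaXbar ⧸ N) = Y at *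
        generalize ψ c hcC X = PX at *
        generalize ψ c hcC Y = PY at *
        rw [mul_assoc X Y (PX * PY), ← mul_assoc Y PX PY, hcommB Y PX, mul_assoc PX Y PY,
          ← mul_assoc X PX (Y * PY), hx, hy, one_mul]
      one_mem' := by simp only [Set.mem_setOf_eq, QuotientGroup.mk_one, map_one, mul_one]
      inv_mem' := by
        intro x hx
        simp only [Set.mem_setOf_eq, QuotientGroup.mk_inv, map_inv] at hx ⊢
        generalize (QuotientGroup.mk x : ↥D.DeltaXbar ⧸ N) = X at *
        generalize ψ c hcC X = PX at *
        have hx' : PX * X = 1 := by rw [hcommB]; exact hx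
        rw [← mul_inv_rev, hx', inv_one] }
  have hS_iff : ∀ (x : D.PiC) (hx : x ∈ D.DeltaXbar), (⟨x, hx⟩ : ↥D.DeltaXbar) ∈ S ↔
      x * (c * x * c⁻¹) ∈ D.deltaEpsKer := by
    intro x hx
    change (QuotientGroup.mk _ : ↥D.DeltaXbar ⧸ N) * ψ c hcC (QuotientGroup.mk _) = 1 ↔ _
    rw [hψ_mk c hcC, ← QuotientGroup.mk_mul, QuotientGroup.eq_one_iff, hN, Subgroup.mem_subgroupOf,
      Subgroup.coe_mul, hφ_coe]
  -- `jKer ⊆ S`: check the two generating pieces of `jKer` (as subgroups of `Π_C`)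
  have hjS : D.jKer ≤ S.map D.DeltaXbar.subtype := by
    refine sup_le ?_ ?_
    · intro n hn
      have hnΔ : n ∈ D.DeltaXbar := D.deltaEpsKer_le_deltaXbar hn
      exact ⟨⟨n, hnΔ⟩, (hS_iff n hnΔ).mpr
        (D.deltaEpsKer.mul_mem hn (C.conj_mem_deltaEpsKer_of_inertiaCentral hI3 hcC hn)), rfl⟩
    · rw [Subgroup.closure_le]
      rintro _ ⟨x, hx, c', hc', hcX', rfl⟩
      have hxc : x * c' * x⁻¹ * c'⁻¹ ∈ D.DeltaXbar := D.jKer_le_deltaXbar (D.commutator_mem_jKer hx hc' hcX')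
      refine ⟨⟨_, hxc⟩, ?_, rfl⟩
      change (QuotientGroup.mk _ : ↥D.DeltaXbar ⧸ N) * ψ c hcC (QuotientGroup.mk _) = 1
      -- the class of `[x, ι̲']` is `x̄ · ι(x̄)⁻¹`
      have e1 : (⟨x * c' * x⁻¹ * c'⁻¹, hxc⟩ : ↥D.DeltaXbar) = ⟨x, hx⟩ * φ c' (⟨x, hx⟩⁻¹) :=
        Subtype.ext (by simp only [Subgroup.coe_mul, hφ_coe, Subgroup.coe_inv]; group)
      have hm : (QuotientGroup.mk (⟨x * c' * x⁻¹ * c'⁻¹, hxc⟩ : ↥D.DeltaXbar) : ↥D.DeltaXbar ⧸ N) =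
          QuotientGroup.mk ⟨x, hx⟩ * (ψ c hcC (QuotientGroup.mk ⟨x, hx⟩))⁻¹ := by
        rw [e1, QuotientGroup.mk_mul, ← hψ_mk c' (D.deltaCbar_le_piCbar hc'), QuotientGroup.mk_inv,
          map_inv, hψ_eq c' hc' hcX']
      have hsq := hψ_sq ⟨x, hx⟩
      rw [hm, map_mul, map_inv, hsq]
      group
  obtain ⟨y, hy, hyj⟩ := hjS hj
  have hjΔ : j ∈ D.DeltaXbar := D.jKer_le_deltaXbar hj
  have hyS : (⟨j, hjΔ⟩ : ↥D.DeltaXbar) ∈ S := by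
    have e : y = ⟨j, hjΔ⟩ := Subtype.ext hyj
    rw [← e]; exact hy
  exact (hS_iff j hjΔ).mp hyS

/-! ### `[Δ_X̲ : jKer] = l` -/

include C in
/-- **[IUTchI] §1 p. 38 — the typed clause `ArrowCoveringClaims.jKer_relindex` (`Δ_ε⁺ ≅ ℤ/lℤ`, i.e.
`[Δ_X̲ : jKer] = l`) DERIVED** from (L0) finiteness of `Δ_X̲^{ab} ⊗ ℤ/l`, (L1) procyclicity of `I_ε′`,
(L2a) "`I_ε′ ≅ ℤ/lℤ`" in `Δ_ε`, (L2c) "`0 → I_ε′ × I_ε″ → Δ_ε`", (L3) "`ι = −1` on `Δ_E ⊗ ℤ/l`", (L4) "`μ_l ⊆ k`",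
and `hι`. ([IUTchI] §1 p.38) [claim: Mochizuki2012, status: disputed] -/
theorem jKer_relindex_of_laws
    (hfin : D.modLKer.relIndex D.DeltaXbar ≠ 0)
    (hgen : ∃ z ∈ D.inertia D.ε1, D.inertia D.ε1 ≤ (Subgroup.zpowers z).topologicalClosure)
    (hord : D.deltaEpsKer.relIndex (D.inertia D.ε1 ⊔ D.deltaEpsKer) = D.l)
    (hind : D.inertia D.ε1 ⊓ (D.inertia D.ε2 ⊔ D.deltaEpsKer) ≤ D.deltaEpsKer)
    (hI3 : ∀ (x : D.Cusp), ∀ g ∈ D.PiXbar, ∀ z ∈ D.inertia x, g * z * g⁻¹ * z⁻¹ ∈ D.modLKer)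
    (hL3 : ∀ c ∈ D.DeltaCbar, c ∉ D.DeltaXbar → ∀ v ∈ D.DeltaXbar,
      c * v * c⁻¹ * v ∈ D.inertia D.ε1 ⊔ D.inertia D.ε2 ⊔ D.deltaEpsKer)
    (hι : ∃ c ∈ D.DeltaCbar, c ∉ D.DeltaXbar) :
    D.jKer.relIndex D.DeltaXbar = D.l := by
  obtain ⟨z, hz, hzgen⟩ := hgen
  obtain ⟨c, hc, hcX⟩ := hι
  have hzΔ : z ∈ D.DeltaXbar := D.inertia_le_deltaXbar _ hz
  have hcC : c ∈ D.PiCbar := D.deltaCbar_le_piCbar hc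
  have hcXP : c ∉ D.PiX := D.not_mem_piX_of_mem_deltaCbar hc hcX
  -- (i) `Δ_X̲ = ⟨z⟩ · jKer`
  have hsup : D.DeltaXbar ≤ Subgroup.zpowers z ⊔ D.jKer := by
    rw [← C.inertia_ε1_sup_of_laws hI3 hL3 ⟨c, hc, hcX⟩]
    exact sup_le (D.le_zpowers_sup_of_le_closure hfin D.modLKer_le_jKer D.jKer_le_deltaXbar hzΔ hzgen)
      le_sup_right
  have hnormJ : (D.jKer.subgroupOf D.DeltaXbar).Normal :=
    D.normal_subgroupOf_of_modLKer_le D.modLKer_le_jKer D.jKer_le_deltaXbar le_rfl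
  -- (ii) the image of `I_ε′` in `Δ_ε` is cyclic of order `l`, generated by `z`
  have hA : D.inertia D.ε1 ⊔ D.deltaEpsKer ≤ Subgroup.zpowers z ⊔ D.deltaEpsKer :=
    sup_le (D.le_zpowers_sup_of_le_closure hfin D.modLKer_le_deltaEpsKer D.deltaEpsKer_le_deltaXbar
      hzΔ hzgen) le_sup_right
  have hnormE : (D.deltaEpsKer.subgroupOf (D.inertia D.ε1 ⊔ D.deltaEpsKer)).Normal :=
    D.normal_subgroupOf_of_modLKer_le D.modLKer_le_deltaEpsKer le_sup_right
      (sup_le (D.inertia_le_deltaXbar _) D.deltaEpsKer_le_deltaXbar)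
  have hzE : ∀ d : ℕ, z ^ d ∈ D.deltaEpsKer ↔ D.l ∣ d := by
    intro d
    rw [← hord]
    exact relIndex_dvd_iff_of_le_zpowers_sup le_sup_right hnormE (Subgroup.mem_sup_left hz) hA d
  -- (iii) conclude by the cyclic quotient lemma for `jKer ⊴ Δ_X̲`
  refine relIndex_eq_of_le_zpowers_sup D.jKer_le_deltaXbar hnormJ hzΔ hsup
    (D.modLKer_le_jKer (D.pow_l_mem_modLKer hzΔ)) fun d hd => ?_
  -- LOWER bound: `z^d ∈ jKer ⇒ z^d · ι̲ z^d ι̲⁻¹ ∈ Ker(Δ_X̲ ↠ Δ_ε)` and `ι̲ z^d ι̲⁻¹ ∈ Ker · I_ε″`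
  have htr := C.trace_mem_deltaEpsKer_of_mem_jKer hI3 hc hcX hd
  have hczd : c * z ^ d * c⁻¹ ∈ D.modLKer ⊔ D.inertia D.ε2 := by
    have e : c * z ^ d * c⁻¹ = (c * z * c⁻¹) ^ d := by rw [conj_pow]
    rw [e]
    exact Subgroup.pow_mem _ (C.conj_inertia_ε1_mem hI3 hcC hcXP hz) d
  have hzd2 : z ^ d ∈ D.inertia D.ε2 ⊔ D.deltaEpsKer := by
    have e : z ^ d = (z ^ d * (c * z ^ d * c⁻¹)) * (c * z ^ d * c⁻¹)⁻¹ := by group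
    rw [e]
    refine Subgroup.mul_mem _ (Subgroup.mem_sup_right htr) (Subgroup.inv_mem _ ?_)
    exact (sup_le (D.modLKer_le_deltaEpsKer.trans le_sup_right) le_sup_left) hczd
  have hzdE : z ^ d ∈ D.deltaEpsKer := hind ⟨Subgroup.pow_mem _ hz d, hzd2⟩
  exact (hzE d).mp hzdE

end CuspGalois

end PuncturedEllipticData

end Literature.IUT.HodgeTheaters
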